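import Literature.NumberTheory.Automorphic.Sweep1
import Literature.NumberTheory.EllipticCurves.HasseWeilAbelian
import Literature.NumberTheory.GaloisRepresentations.IntegralGaloisActionProofs
import HarnessLib

/-!
# Potential modularity of elliptic curves over CM fields (lang.S28): the Galois-side
statement of Allen et al. and the reduction of `Literature.NumberTheory.Automorphic.exists_isCMField_isModular`

Sibling file of `Literature.NumberTheory.Automorphic.Sweep1` (namespace `Literature.Lang`), landed by
the tenured seat of the named fact `Literature.NumberTheory.Automorphic.exists_isCMField_isModular` (**lang.S28**;
Allen–Calegari–Caraiani–Gee–Helm–Le Hung–Newton–Scholze–Taylor–Thorne, *Potential automorphy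
over CM fields*, Ann. of Math. 197 (2023), Thm. 1.0.1). That fact transcribes the theorem
purely on the automorphic side of the tree: a cuspidal `Π ≤ L²_cusp(GL₂(F') \ GL₂(𝔸_{F'}) / A_G)`
(`CuspidalAutomorphicRepGL`) whose Hecke eigenvalues at a level `K(𝔫)` reproduce Mathlib's local
polynomials `L_v(E, T)` (`WeierstrassCurve.IsModular`). The printed theorem is a statement about
the compatible system of `ℓ`-adic representations of `E`: in §7.1 of the source a compatible
system `R = (M, S, {Q_v}, {r_λ}, {H_τ})` is *automorphic* iff there is a regular algebraic
cuspidal automorphic representation `π` of `GL_n(𝔸_F)` (and `ı : M ↪ ℂ`) such that for `v ∉ S`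
the local component `π_v` is unramified and `rec(π_v |det|_v^{(1-n)/2})(Frob_v)` has
characteristic polynomial `ı(Q_v(X))`, and Cor. 7.1.12 (the "simpler immediate consequence" of
the main Theorem 7.1.11) says that a strongly irreducible rank-2 very weakly compatible system
with Hodge–Tate numbers `{0, 1}` over a CM field becomes automorphic over a finite Galois CM
extension. This file defines that Galois-side reading for the system `R_E` of an elliptic curve
on the objects the tree has (`WeierstrassCurve.IsTateAutomorphic`), and **proves** the `Sweep1`
transcription from the Galois-side statement — taken as an explicit hypothesis — and four
standard facts that `Literature` already carries.

**This file carries no named fact** (review of the split, 2026-08-15, D-0026 / D-0027 A7): its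
former named fact `exists_isCMField_isTateAutomorphic` — the printed Cor. 7.1.12 for `m = 1` and
`R = R_E` read as "`E ×_F F'` is Tate-automorphic over a finite Galois CM extension `F'/F`", a
decomposition child of `Literature.NumberTheory.Automorphic.exists_isCMField_isModular` carrying
the *whole* difficulty of its parent (the tree proves it equivalent to the parent strengthened by
the single printed word "Galois": `exists_isCMField_isTateAutomorphic_iff`,
`WeierstrassCurve.isTateAutomorphic_iff_isModular` of `Sweep1PotentialModularityEquivalenceProofs`)
— has been merged back into the parent's proof obligation. Its statement survives verbatim as
the explicit hypothesis `hACC` of the reduction theorem `exists_isCMField_isModular_of_isTateAutomorphic`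
below and of its sharpenings in the `Sweep1PotentialModularity…Proofs` siblings (ending with
`exists_isCMField_isModular_of_exists_isCMField_isTateAutomorphic`: the hypothesis alone implies
the parent), and as the conclusion of `exists_isCMField_isTateAutomorphic_of_forall_isSolvable`
(`Sweep1PotentialModularitySolubleDescent`), which derives it from the tree's one named fact for
this theorem of the source, the strong form with soluble descent
`exists_isCMField_forall_isSolvable_isTateAutomorphic` (Cor. 7.1.12 with Prop. 6.5.13 (2),
requested by the route `Langlands/AnalyticDescent`). Contents:

* `WeierstrassCurve.IsTateAutomorphic W` (**definition**, source §7.1 "`R` is automorphic",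
  read for `R = R_E` at all but finitely many places, in the unitary Satake normalisation of
  the accepted G19 prelude `GLnAdelicStructure`): there are an automorphic measure, a cuspidal
  `Π ≤ L²_cusp(GL₂)` and ONE level `𝔫 ≠ 0` such that for all but finitely many finite places
  `v` (all prime to `𝔫`) there are a Satake parameter `α = {α₁, α₂}` of `Π` at `v` w.r.t.
  `K(𝔫)` and an integer `a` with `∏_{z ∈ α} (X - q_v^{1/2} z) = X² - a X + q_v` and, for every
  prime `ℓ` with `v ∤ ℓ` (and every continuity/finiteness witness of `V_ℓ E`, see below), the
  rational Tate module `V_ℓ E` (`Literature.rationalTateGaloisRepOf (geomPoints W) ℓ h` of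
  `HasseWeilAbelian`) is unramified at `v` with arithmetic-Frobenius characteristic polynomial
  `X² - a X + q_v` (`GaloisRep.IsUnramifiedAt`, `GaloisRep.HasFrobCharpolyAt` of G09
  `GaloisRep`). API: `IsTateAutomorphic.eventually_isUnramifiedAt` (the Galois half alone) and
  the bridge `IsTateAutomorphic.isModular` below.
* the **Galois form of lang.S28** (source Cor. 7.1.12 for `m = 1` and `R = R_E`, i.e.
  Thm. 1.0.1 for a non-CM `E`; a hypothesis, formerly the named fact
  `exists_isCMField_isTateAutomorphic`): for an elliptic curve `E` without geometric CM over a CM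
  field `F` there is a finite extension `F'/F`, Galois, with `F'` a CM field, such that
  `E ×_F F'` is Tate-automorphic.
* `WeierstrassCurve.IsTateAutomorphic.isModular` (**proved**): `W.IsTateAutomorphic →
  W.IsModular`, given at ONE auxiliary prime `ℓ` the four standard facts (all vendored earlier as
  named facts, cited in their files): continuity and finite-dimensionality of `V_ℓ E`
  (`WeierstrassCurve.continuous_rationalGaloisRepTate`, `module_finite_rationalTateModule` of
  `TateModule`; Silverman III.7.1, Serre I.1.2), the Euler factor of `V_ℓ E` at `v ∤ ℓ` is
  Mathlib's local polynomial (`WeierstrassCurve.hasseWeilEulerFactor_geomPoints`; Silverman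
  V.2.3.1, VII.4.1, C.§16; Serre–Tate Thm. 3) and equals `det(1 - Frob_v T)` at unramified `v`
  (`Literature.NumberTheory.EllipticCurves.hasseWeilEulerFactor_eq_reverse_frobCharpoly`; Serre I.2.3).
* `exists_isCMField_isModular_of_isTateAutomorphic` (**proved**): the Galois form (hypothesis)
  and the four facts (for all elliptic curves over number fields, at one prime `ℓ`) imply
  `Literature.NumberTheory.Automorphic.exists_isCMField_isModular`. So lang.S28 as stated in `Sweep1` rests on exactly one
  deep input, Cor. 7.1.12 of the source for `R_E` (the obligation itself), plus
  Silverman/Serre–Tate-level facts (all proved since, see the `…Proofs` siblings).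
* Elementary helpers (**proved**): the Frobenius polynomial `frobPoly a q = X² - a X + q`, its
  reverse `eulerPoly a q = 1 - a X + q X²` (`reverse_frobPoly`, `reverse_map_frobPoly`),
  `coeff_quadratic_eq`, `X_sub_C_mul_X_sub_C`, `one_sub_mul_one_sub`,
  `eventually_natCast_not_mem_asIdeal` (a rational prime lies in only finitely many `v`).

## Source (read: arXiv 1812.09999v2, 16 Jun 2022, the text of the Annals version; and the held
copy `lit:arxiv-1812.09999`)

* Thm. 1.0.1 (p. 3, "a special case of Corollaries 7.1.13 and 7.1.14"): *Let `E` be an elliptic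
  curve over a CM number field `F`. Then `E` and all the symmetric powers of `E` are potentially
  modular.*
* §7.1, first definition: a rank `n` **very weakly compatible system** `R` of `l`-adic
  representations of `G_F` defined over `M` is a 5-tuple `(M, S, {Q_v(X)}, {r_λ}, {H_τ})` with
  `M` a number field, `S` a finite set of primes of `F`, `Q_v(X) ∈ M[X]` monic of degree `n` for
  `v ∉ S`, `H_τ` a multiset of `n` integers, `r_λ : G_F → GL_n(M̄_λ)` continuous semisimple with
  (5a) *if `v ∉ S` and `v ∤ l` then `r_λ` is unramified at `v` and `r_λ(Frob_v)` has
  characteristic polynomial `Q_v(X)`*, (5b) crystallinity with `HT_τ(r_λ) = H_τ` for `l` outside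
  a density-`0` set, (5c) `HT_τ(det r_λ) = ∑ H_τ`; *strongly irreducible*: `R|_{G_{F'}}`
  irreducible for every finite `F'/F`.
* §7.1: *The very weakly compatible system `R` is defined to be automorphic if there is a
  regular algebraic, cuspidal automorphic representation `π` of `GL_n(𝔸_F)` and an embedding
  `ı : M ↪ ℂ`, such that if `v ∉ S`, then `π_v` is unramified and
  `rec(π_v |det|_v^{(1-n)/2})(Frob_v)` has characteristic polynomial `ı(Q_v(X))`.*
* Thm. 7.1.11 (main theorem; strongly irreducible rank-2 very weakly compatible systems `R_i`
  with `H_τ = {0,1}` over a CM `F`, fields `F^suffices`, `F^avoid`) and **Cor. 7.1.12**: *Suppose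
  that `F` is a CM field and that `R = (M, S, {Q_v(X)}, {r_λ}, {{0,1}})` is a strongly
  irreducible rank 2 very weakly compatible system of `l`-adic representations of `G_F`. If `m`
  is a non-negative integer, then there exists a finite Galois CM extension `F'/F` such that the
  weakly compatible system `Symm^m R|_{G_{F'}}` is automorphic.*
* Cor. 7.1.13 (purity and potential modularity of irreducible rank-2 systems with
  `H_τ = {0,1}` and their symmetric powers) and Cor. 7.1.14 (Sato–Tate for a non-CM elliptic
  curve over a CM field, "This follows from Corollary 7.1.13 …"): the paper applies §7.1 to
  the system of an elliptic curve, `R_E = (ℚ, S_E, {X² - a_v X + q_v}, {r_{E,l}}, {{0,1}})`,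
  `a_v = q_v + 1 - #Ẽ(k_v)`; for non-CM `E` it is strongly irreducible (as used for the last part
  of Cor. 7.1.13). Cor. 7.2.4 records the shape `Symm^m r_{E,l}|^∨_{G_{F'}} ≅ r_{l,ı}(π)`.
* §1, Notation: `Frob_K` is the **geometric** Frobenius; `Art_K` is normalised to send
  uniformizers to geometric Frobenius elements; `rec_K` is the local Langlands correspondence
  of Harris–Taylor, and `π₁ ⊞ π₂` is defined by `rec(π₁ ⊞ π₂) = rec(π₁) ⊕ rec(π₂)`.
* Proof architecture of Thm. 7.1.11 (§7.2.5, recorded for tenure): auxiliary non-CM `E₀/ℚ` and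
  primes `l₁, l₂` (Assumption 7.2.6, densities by Lemma 7.1.3); Grunwald–Wang; moduli of
  elliptic curves with prescribed `l₁`- and `l₂`-torsion and Moret-Bailly's theorem for CM
  points; potential automorphy of `Symm^m` of a non-CM `E₀/ℚ` over totally real fields
  (Prop. 7.2.3 = the [BLGGT14] variant, Cor. 7.2.4); the automorphy lifting theorems 6.1.1
  (Fontaine–Laffaille) and 6.1.2 (ordinary), applied at `l₂` and then `l₁`; soluble descent
  (Prop. 6.5.13). Their hypotheses (crystalline/ordinary local conditions at `v ∣ p`,
  Hodge–Tate weights labelled by embeddings, decomposed-generic and enormous-image residual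
  conditions) have no carrier in Mathlib or `Literature` (G09 `PAdicHodge` exposes only
  abstract unlabelled period-ring data), so no printed intermediate result below Cor. 7.1.12
  can be vendored faithfully today; the corollary for `R_E` is the honest unit of debt — carried
  by the obligation `exists_isCMField_isModular` itself (and by the route-requested strong form
  `exists_isCMField_forall_isSolvable_isTateAutomorphic`), not by a named fact of this file.

## Normalisations (why `IsTateAutomorphic` reads the printed condition correctly)

* *Galois side.* `r_{E,l}` in `R_E` (Hodge–Tate numbers `{0,1}` in the convention of §1, where
  `ε_l` has Hodge–Tate number `-1`) is `H¹_ét(E_{F̄}, ℚ̄_l) ≅ V_l(E)^∨`, and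
  `Q_v(X) = det(X - Frob_v | H¹)` for the geometric Frobenius. Since `ρ^∨(σ⁻¹) = ρ(σ)ᵀ`, this is
  `det(X - σ_v | V_l E)` for an *arithmetic* Frobenius `σ_v` — exactly the tree's convention
  (`GaloisRep.HasFrobCharpolyAt`, Mathlib `IsArithFrobAt`) for the tree's `V_ℓ E`. At a place of
  good reduction `v ∤ l`, `σ_v` acts on `T_l E ≅ T_l Ẽ` as the `q_v`-power Frobenius endomorphism,
  so `Q_v = X² - a_v X + q_v ∈ ℤ[X]`, `a_v = q_v + 1 - #Ẽ(k_v)` (Silverman V.2.3.1, VII.4.1):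
  `frobPoly a q_v` with `M = ℚ`, `ı` the inclusion. Condition (5a) is our Galois conjunct, with
  the printed guard `v ∤ l` and one exceptional set for all `l` (as printed: `S` does not depend
  on `λ`).
* *Automorphic side.* An unramified `π_v` is `χ₁ ⊞ χ₂ ↪ π(χ₁, χ₂)` (unitarily normalised
  induction, `χ_i` unramified); put `α_i = χ_i(ϖ_v)`. By §1, `rec(π_v) = (χ₁ ⊕ χ₂) ∘ Art⁻¹`, so
  `rec(π_v)(Frob_v) ∼ diag(α₁, α₂)` and `rec(π_v |det|_v^{-1/2})(Frob_v)` has eigenvalues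
  `|ϖ_v|^{-1/2} α_i = q_v^{1/2} α_i`. On the other hand the spherical vector of `π(χ₁, χ₂)` has
  `T(𝔭)`-eigenvalue `q^{1/2}(α₁ + α₂)` and `R(𝔭)`-eigenvalue `α₁ α₂` (Bump, *Automorphic Forms
  and Representations*, Prop. 4.6.6), i.e. `{α₁, α₂}` is the multiset `α` of the tree's
  `HasSatakeParameterAt Π K(𝔫) v ϖ α` (eigenvalues `q_v^{i(n-i)/2} e_i(α)` of `T_{v,i}`,
  `GLnAdelicStructure`). Hence the printed condition reads `∏_{z ∈ α} (X - q_v^{1/2} z) = Q_v(X)`,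
  our automorphic conjunct; for `R_E`: `q_v^{1/2}(α₁ + α₂) = a_v`, `α₁ α₂ = 1`. Its reverse is
  the condition `∏ (1 - q_v^{1/2} z T) = 1 - a_v T + q_v T² = L_v(E, T)` of
  `WeierstrassCurve.IsModular` (`Sweep1`) — this is what `IsTateAutomorphic.isModular` checks in
  the kernel, through the Euler factor of `V_ℓ E`.
* *From `π` to `Π`, one level.* For `R_E` the `T_{v,2}`-eigenvalues are `α₁ α₂ = 1` at almost
  all `v`, so the central character of `π` is trivial (continuity and weak approximation) and the
  cusp forms of `π` live on `GL₂(F) \ GL₂(𝔸_F) / A_G`; the `L²`-closure of (an irreducible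
  summand of the forms of) `π` is an irreducible closed `Π ≤ L²_cusp` (Borel–Jacquet 1979,
  4.4–4.6; the dictionary is recorded by the named facts `exists_isAssociatedL2`,
  `hasSatakeParamAt_iff_L2` of `AutomorphicRepsGL`), `π^{K(𝔫)} ≠ 0` for some `𝔫 ≠ 0`, and for
  `v ∤ 𝔫`, `v ∉ S` every vector of `Π^{K(𝔫)} = π_v^{GL₂(𝒪_v)} ⊗ (π^v)^{K(𝔫)^v}` is a
  `T_{v,i}`-eigenvector with the eigenvalues of the spherical line of `π_v`. So "`R_E|_{G_{F'}}`
  is automorphic" implies `(E ×_F F').IsTateAutomorphic`.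
* *What is dropped (weaker than the source, never stronger).* "regular algebraic (of weight
  `0`)" is not asserted (the `L²` objects of G19 carry no infinity-type predicate; the
  `CuspidalAutomorphicRepData` language of `AutomorphicRepsGL` has `HasWeightZero` but no proved
  bridge to `HasSatakeParameterAt` at a fixed level); "for all `v ∉ S_E`" is replaced by "for all
  but finitely many `v`" (as in both accepted formulations of lang.S28); `F'/F` Galois IS kept
  (`IsGalois F F'`).

## Design notes

* The continuity proof `h` and the finiteness proof of `V_ℓ E` are universally quantified inside
  `IsTateAutomorphic` (they are the named facts `continuous_rationalGaloisRepTate`,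
  `module_finite_rationalTateModule` of `TateModule`, review 5 of `HasseWeilAbelian`: arguments,
  not instances); the statement is insensitive to the witnesses (proofs of propositions), and the
  bridge theorem takes the two facts as hypotheses to instantiate them.
* Places: `∀ᶠ v in cofinite` first, then `∀ ℓ` with the guard `(ℓ : 𝓞 F) ∉ v.asIdeal` — the
  exceptional set is uniform in `ℓ` (bad places and the support of `𝔫`), as in the source; the
  bridge fixes one `ℓ` and discards the finitely many `v ∣ ℓ`
  (`eventually_natCast_not_mem_asIdeal`, Mathlib `Ideal.finite_factors`).
* Uniqueness of Frobenius characteristic polynomials at `v` (needed to pass from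
  `HasFrobCharpolyAt v Q` to `frobCharpoly v = Q`) is proved inline from
  `HeightOneSpectrum.primesAbove_nonempty` and the discharged fact
  `exists_isArithFrobAt_of_mem_primesAbove_holds` (`IntegralGaloisActionProofs`).
* `IsTateAutomorphic` does not assume `[W.IsElliptic]` (like `IsModular`; for singular `W` both
  are junk notions); the fact and the bridge do. `(W.baseChange F').IsElliptic` is Mathlib's
  instance for `W.map` after unfolding `baseChange`.
* Universe: number fields in `Type` (as `Sweep1`, `GLnCuspidalSpectrum`); `HasseWeilAbelian`'s
  universe-polymorphic declarations are used at `u = 0`.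
* Mathlib (grepped): `WeierstrassCurve.localPolynomial`, `Polynomial.reverse`, `revAt`,
  `natDegree_quadratic`, `Polynomial.map_injective`, `Multiset.card_eq_two`,
  `Ideal.finite_factors`, `Ideal.dvd_span_singleton`, `IsGalois`, `NumberField.IsCMField`.
  Mathlib has no automorphic representations, no Galois representation of an elliptic curve
  over a number field and no modularity statement (grep `modular`, `automorphic` in
  `Mathlib/NumberTheory`: only classical modular forms).
* No new instances; no `sorry`.

## References

* P. B. Allen, F. Calegari, A. Caraiani, T. Gee, D. Helm, B. V. Le Hung, J. Newton, P. Scholze,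
  R. Taylor, J. A. Thorne, *Potential automorphy over CM fields*, Ann. of Math. (2) 197 (2023),
  897–1113 (arXiv:1812.09999v2): §1 (Notation), Thm. 1.0.1, §7.1 (definitions), Thm. 7.1.11,
  Cor. 7.1.12–7.1.14, §7.2. [AllenCalegariCaraianiGeeEtAl2023]
* J. H. Silverman, *The Arithmetic of Elliptic Curves*, 2nd ed., GTM 106 (2009), III.7.1,
  V.2.3.1, VII.4.1, C.§16. [SilvermanAEC2009]
* J.-P. Serre, *Abelian ℓ-adic representations and elliptic curves* (1968), Ch. I §1.2, §2.1,
  §2.3. [SerreAbelianLadic1968]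
* J.-P. Serre, J. Tate, *Good reduction of abelian varieties*, Ann. of Math. 88 (1968), Thm. 3.
  [SerreTate1968]
* D. Bump, *Automorphic Forms and Representations* (1997), Prop. 4.6.6; A. Borel, H. Jacquet,
  *Automorphic forms and automorphic representations*, Corvallis (1979), §4.4–4.6.
-/

noncomputable section

open scoped MatrixGroups Polynomial NumberField
open NumberField IsDedekindDomain MeasureTheory Filter Polynomial

namespace Literature.NumberTheory.Automorphic


/-! ### The Frobenius polynomial `X² - a X + q` and its reverse `1 - a X + q X²` -/

section FrobPoly

/-- The rank-two **Frobenius polynomial** `Q_{a,q}(X) = X² - a X + q ∈ ℤ[X]` with trace `a`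
and determinant `q`: for an elliptic curve at a place `v` of good reduction, `a = a_v =
q_v + 1 - #Ẽ(k_v)` and `q = q_v`, the characteristic polynomial of Frobenius on the Tate module
(Silverman, *AEC*, V.2.3.1; the polynomial `Q_v(X)` of the compatible system `R_E`, source §7.1).
[cite: SilvermanAEC2009, Thm. V.2.3.1] -/
def frobPoly (a : ℤ) (q : ℕ) : ℤ[X] :=
  X ^ 2 - C a * X + C (q : ℤ)

/-- The **reversed Frobenius polynomial** `1 - a T + q T² ∈ ℤ[T]`, i.e. `det(1 - Frob T)` in the
variable `T = q^{-s}`: the shape of Mathlib's `WeierstrassCurve.localPolynomial` at a place of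
good reduction (Silverman, *AEC*, C.§16). [cite: SilvermanAEC2009, C.§16] -/
def eulerPoly (a : ℤ) (q : ℕ) : ℤ[X] :=
  1 - C a * X + C (q : ℤ) * X ^ 2

/-- `frobPoly` in the normal form of Mathlib's `natDegree_quadratic`. [folklore] -/
theorem frobPoly_eq (a : ℤ) (q : ℕ) :
    frobPoly a q = C 1 * X ^ 2 + C (-a) * X + C (q : ℤ) := by
  simp only [frobPoly, map_one, one_mul, map_neg, neg_mul]
  ring

/-- `X² - a X + q` has degree `2`. [folklore] -/
theorem natDegree_frobPoly (a : ℤ) (q : ℕ) : (frobPoly a q).natDegree = 2 := by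
  rw [frobPoly_eq]
  exact natDegree_quadratic one_ne_zero

/-- The coefficients of `X² - a X + q`. [folklore] -/
@[simp] theorem coeff_frobPoly (a : ℤ) (q : ℕ) (n : ℕ) :
    (frobPoly a q).coeff n =
      if n = 2 then 1 else if n = 1 then -a else if n = 0 then (q : ℤ) else 0 := by
  simp only [frobPoly, coeff_add, coeff_sub, coeff_X_pow, coeff_C_mul, coeff_X, coeff_C]
  rcases n with _ | _ | _ | n <;> simp

/-- The coefficients of `1 - a X + q X²`. [folklore] -/
@[simp] theorem coeff_eulerPoly (a : ℤ) (q : ℕ) (n : ℕ) :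
    (eulerPoly a q).coeff n =
      if n = 0 then 1 else if n = 1 then -a else if n = 2 then (q : ℤ) else 0 := by
  simp only [eulerPoly, coeff_add, coeff_sub, coeff_one, coeff_C_mul, coeff_X, coeff_X_pow]
  rcases n with _ | _ | _ | n <;> simp

/-- `reverse (X² - a X + q) = 1 - a X + q X²` (Mathlib `Polynomial.reverse`, `coeff_reverse`).
[folklore] -/
theorem reverse_frobPoly (a : ℤ) (q : ℕ) : (frobPoly a q).reverse = eulerPoly a q := by
  ext n
  rw [coeff_reverse, natDegree_frobPoly, coeff_frobPoly, coeff_eulerPoly]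
  rcases n with _ | _ | _ | n
  · simp [revAt_le]
  · simp [revAt_le]
  · simp [revAt_le]
  · have h3 : ¬ n + 3 ≤ 2 := by omega
    simp [revAt, h3]

/-- `X² - a X + q` is monic. [folklore] -/
theorem monic_frobPoly (a : ℤ) (q : ℕ) : (frobPoly a q).Monic := by
  rw [Monic, leadingCoeff, natDegree_frobPoly, coeff_frobPoly]
  simp

/-- `reverse` and `map` on the Frobenius polynomial: over any non-trivial commutative ring `S`,
`reverse ((X² - a X + q).map f) = (1 - a X + q X²).map f`. [folklore] -/
theorem reverse_map_frobPoly {S : Type*} [CommRing S] [Nontrivial S] (f : ℤ →+* S) (a : ℤ)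
    (q : ℕ) : ((frobPoly a q).map f).reverse = (eulerPoly a q).map f := by
  ext n
  rw [coeff_reverse, (monic_frobPoly a q).natDegree_map f, natDegree_frobPoly, coeff_map,
    coeff_map, coeff_frobPoly, coeff_eulerPoly]
  rcases n with _ | _ | _ | n
  · simp [revAt_le]
  · simp [revAt_le]
  · simp [revAt_le]
  · have h3 : ¬ n + 3 ≤ 2 := by omega
    simp [revAt, h3]

/-- Comparing coefficients of two normalised quadratics `X² - s X + p = X² - s' X + p'`.
[folklore] -/
theorem coeff_quadratic_eq {R : Type*} [CommRing R] {s p s' p' : R}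
    (h : (X : R[X]) ^ 2 - C s * X + C p = X ^ 2 - C s' * X + C p') : s = s' ∧ p = p' := by
  constructor
  · have := congrArg (fun f : R[X] => f.coeff 1) h
    simpa using this
  · have := congrArg (fun f : R[X] => f.coeff 0) h
    simpa using this

/-- `(X - u)(X - w) = X² - (u + w) X + u w`. [folklore] -/
theorem X_sub_C_mul_X_sub_C {R : Type*} [CommRing R] (u w : R) :
    (X - C u) * (X - C w) = X ^ 2 - C (u + w) * X + C (u * w) := by
  simp only [map_add, map_mul]; ring

/-- `(1 - u X)(1 - w X) = 1 - (u + w) X + u w X²`. [folklore] -/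
theorem one_sub_mul_one_sub {R : Type*} [CommRing R] (u w : R) :
    (1 - C u * X) * (1 - C w * X) = 1 - C (u + w) * X + C (u * w) * X ^ 2 := by
  simp only [map_add, map_mul]; ring

end FrobPoly

/-! ### A rational prime lies below only finitely many finite places -/

section Places

/-- For a non-zero natural number `ℓ`, all but finitely many finite places `v` of the number
field `F` satisfy `ℓ ∉ v` (the primes containing `ℓ` are the finitely many prime factors of the
non-zero ideal `(ℓ)`, Mathlib `Ideal.finite_factors`). [folklore] -/
theorem eventually_natCast_not_mem_asIdeal (F : Type*) [Field F] [NumberField F] {ℓ : ℕ}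
    (hℓ : ℓ ≠ 0) : ∀ᶠ v : HeightOneSpectrum (𝓞 F) in cofinite, (ℓ : 𝓞 F) ∉ v.asIdeal := by
  have hne : Ideal.span {(ℓ : 𝓞 F)} ≠ ⊥ := by
    rw [Ne, Ideal.span_singleton_eq_bot]
    exact_mod_cast hℓ
  refine Filter.mem_of_superset (Ideal.finite_factors hne).compl_mem_cofinite ?_
  intro v hv hmem
  exact hv (Ideal.dvd_span_singleton.2 hmem)

end Places

/-! ### Automorphy of the compatible system of an elliptic curve (source §7.1), and lang.S28 -/

section TateAutomorphic

/-- The Weierstrass curve `W / F` (an elliptic curve `E` over the number field `F`) is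
**Tate-automorphic**: the compatible system `R_E = (ℚ, S_E, {X² - a_v X + q_v}, {V_ℓ(E)^∨},
{{0,1}})` of its `ℓ`-adic representations (`V_ℓ(E)^∨ = H¹_ét(E_{F̄}, ℚ_ℓ)`; the characteristic
polynomial of the geometric Frobenius on `V_ℓ(E)^∨` is that of the arithmetic Frobenius on
`V_ℓ E`) *is automorphic* in the sense of Allen et al., §7.1 ("there is a
regular algebraic, cuspidal automorphic representation `π` of `GL_n(𝔸_F)` and an embedding
`ı : M ↪ ℂ`, such that if `v ∉ S`, then `π_v` is unramified and `rec(π_v |det|_v^{(1-n)/2})(Frob_v)`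
has characteristic polynomial `ı(Q_v(X))`"), read at all but finitely many places on the tree's
objects and in the unitary Satake normalisation of G19 (module docstring, "Normalisations"):
there are an automorphic measure `μ`, a cuspidal automorphic representation
`Π ≤ L²_cusp(GL₂(F) \ GL₂(𝔸_F) / A_G)` (`CuspidalAutomorphicRepGL 2 F μ`) and one level `𝔫 ≠ 0`
such that for all but finitely many finite places `v` of `F`: `v ∤ 𝔫`, and there are a
uniformizer `ϖ`, a Satake parameter `α = {α₁, α₂}` of `Π` at `v` with respect to `K(𝔫)`
(`HasSatakeParameterAt`) and an integer `a` with
* `∏_{z ∈ α} (X - q_v^{1/2} z) = X² - a X + q_v` in `ℂ[X]` (the eigenvalues of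
  `rec(Π_v |det|_v^{-1/2})(Frob_v)`, geometric `Frob_v`, are the `q_v^{1/2} α_i`), and
* for every prime `ℓ` with `v ∤ ℓ` and every continuity witness `h` and finiteness witness of
  the rational Tate module `V_ℓ E` (the named facts `continuous_rationalGaloisRepTate`,
  `module_finite_rationalTateModule` of `TateModule`), the Galois representation
  `V_ℓ E = rationalTateGaloisRepOf (geomPoints W) ℓ h` is unramified at `v` and every arithmetic
  Frobenius at `v` has characteristic polynomial `X² - a X + q_v` on it
  (`GaloisRep.IsUnramifiedAt`, `GaloisRep.HasFrobCharpolyAt`; condition (5a) of a very weakly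
  compatible system, with `Q_v ∈ ℤ[X] ⊆ ℚ_ℓ[X]`).

Then `a = a_v(E)` and `L_v(E, T) = 1 - a T + q_v T²` at these places (`IsTateAutomorphic.isModular`).
"Regular algebraic of weight `0`" is not asserted and "`v ∉ S_E`" is weakened to "all but
finitely many `v`" (module docstring). Like `WeierstrassCurve.IsModular` this is stated for every
Weierstrass curve; for singular `W` it is a junk notion. Deliberate dot-notation extension of
Mathlib's `WeierstrassCurve` namespace, as `IsModular` in `Sweep1`.
[cite: AllenCalegariCaraianiGeeEtAl2023, §7.1 (definition of an automorphic compatible system, for R = R_E)] -/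
def _root_.WeierstrassCurve.IsTateAutomorphic {F : Type} [Field F] [NumberField F]
    (W : WeierstrassCurve F) : Prop :=
  ∃ (μ : Measure (AdelicGroupData.gl 2 F).automorphicQuotient)
    (_ : (AdelicGroupData.gl 2 F).IsAutomorphicMeasure μ) (P : CuspidalAutomorphicRepGL 2 F μ)
    (𝔫 : Ideal (𝓞 F)) (_ : 𝔫 ≠ 0),
    ∀ᶠ v : HeightOneSpectrum (𝓞 F) in cofinite,
      ¬ v.asIdeal ∣ 𝔫 ∧ ∃ (ϖ : (v.adicCompletion F)ˣ) (α : Multiset ℂ) (a : ℤ),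
        HasSatakeParameterAt P.1 (principalCongruenceLevel 2 F 𝔫) v ϖ α ∧
        (α.map fun z => (X : ℂ[X]) -
            Polynomial.C (((Real.sqrt (v.residueCard : ℝ) : ℝ) : ℂ) * z)).prod =
          (frobPoly a v.residueCard).map (Int.castRingHom ℂ) ∧
        ∀ (ℓ : ℕ) [Fact ℓ.Prime], (ℓ : 𝓞 F) ∉ v.asIdeal →
          ∀ (h : Continuous fun x : Field.absoluteGaloisGroup F × W.rationalTateModule ℓ =>
              EllipticCurves.rationalTateRepresentation (Field.absoluteGaloisGroup F)
                (WeierstrassCurve.geomPoints W) ℓ x.1 x.2)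
            (_ : Module.Finite ℚ_[ℓ] (W.rationalTateModule ℓ)),
            (EllipticCurves.rationalTateGaloisRepOf (WeierstrassCurve.geomPoints W) ℓ h).IsUnramifiedAt v ∧
            (EllipticCurves.rationalTateGaloisRepOf (WeierstrassCurve.geomPoints W) ℓ h).HasFrobCharpolyAt v
              ((frobPoly a v.residueCard).map (Int.castRingHom ℚ_[ℓ]))

/-- **The Galois half of Tate-automorphy.** If `W` is Tate-automorphic then for every prime `ℓ`
(and all witnesses `h`, `hfin`) the rational Tate module `V_ℓ E` is unramified at all but finitely
many places `v`, with integral Frobenius characteristic polynomial `X² - a X + q_v` for some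
`a ∈ ℤ` (condition (5a) of a very weakly compatible system at almost all places; source §7.1).
The finitely many `v ∣ ℓ` are discarded by `eventually_natCast_not_mem_asIdeal`.
[cite: AllenCalegariCaraianiGeeEtAl2023, §7.1] -/
theorem _root_.WeierstrassCurve.IsTateAutomorphic.eventually_isUnramifiedAt {F : Type} [Field F]
    [NumberField F] {W : WeierstrassCurve F} (hW : W.IsTateAutomorphic) (ℓ : ℕ) [Fact ℓ.Prime]
    (h : Continuous fun x : Field.absoluteGaloisGroup F × W.rationalTateModule ℓ =>
      EllipticCurves.rationalTateRepresentation (Field.absoluteGaloisGroup F) (WeierstrassCurve.geomPoints W) ℓ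
        x.1 x.2)
    (hfin : Module.Finite ℚ_[ℓ] (W.rationalTateModule ℓ)) :
    ∀ᶠ v : HeightOneSpectrum (𝓞 F) in cofinite,
      (EllipticCurves.rationalTateGaloisRepOf (WeierstrassCurve.geomPoints W) ℓ h).IsUnramifiedAt v ∧
        ∃ a : ℤ, (EllipticCurves.rationalTateGaloisRepOf (WeierstrassCurve.geomPoints W) ℓ h).HasFrobCharpolyAt v
          ((frobPoly a v.residueCard).map (Int.castRingHom ℚ_[ℓ])) := by
  obtain ⟨μ, hμ, P, 𝔫, h𝔫, hev⟩ := hW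
  filter_upwards [hev, eventually_natCast_not_mem_asIdeal F (Fact.out : ℓ.Prime).ne_zero]
    with v hv hvℓ
  obtain ⟨-, -, -, a, -, -, hGal⟩ := hv
  obtain ⟨hunr, hFrob⟩ := hGal ℓ hvℓ h hfin
  exact ⟨hunr, a, hFrob⟩

/-- **From the Galois form to `Sweep1`'s automorphic form.** A Tate-automorphic elliptic curve
is modular in the sense of `WeierstrassCurve.IsModular` (`Sweep1`: the same `Π` and level `𝔫`,
with `L_v(E, T) = ∏_{z ∈ α} (1 - q_v^{1/2} z T)` at all but finitely many `v`), given, at one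
auxiliary prime `ℓ`, the four standard facts: continuity and finite-dimensionality of `V_ℓ E`
(`continuous_rationalGaloisRepTate`, `module_finite_rationalTateModule`; Silverman III.7.1,
Serre I.1.2), the identification of the Euler factor `det(1 - σ_v T | (V_ℓ E)_{I_v})`, `v ∤ ℓ`,
with Mathlib's `localPolynomial` (`hasseWeilEulerFactor_geomPoints`; Silverman V.2.3.1, VII.4.1,
C.§16, Serre–Tate Thm. 3) and with `det(1 - Frob_v T | V_ℓ E)` at unramified `v`
(`hasseWeilEulerFactor_eq_reverse_frobCharpoly`; Serre I.2.3). Proof: at a place `v ∤ ℓ 𝔫` of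
the cofinite set, all arithmetic Frobenii at `v` have characteristic polynomial `X² - a X + q_v`
on `V_ℓ E`, so (a prime above `v` and a Frobenius at it exist: `primesAbove_nonempty`,
`exists_isArithFrobAt_of_mem_primesAbove_holds`) `frobCharpoly v = X² - a X + q_v`; the two
Euler-factor facts give `L_v(E, T) = reverse (X² - a X + q_v) = 1 - a T + q_v T²` in `ℚ_ℓ[T]`,
hence in `ℤ[T]` (`ℤ → ℚ_ℓ` is injective); and comparing coefficients in
`(X - q^{1/2} α₁)(X - q^{1/2} α₂) = X² - a X + q` gives
`(1 - q^{1/2} α₁ T)(1 - q^{1/2} α₂ T) = 1 - a T + q T²`. Silverman, *AEC*, V.2.3.1 and C.§16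
(`L_v(E, T) = 1 - a_v T + q_v T²`, `a_v` the trace of Frobenius).
[cite: SilvermanAEC2009, Thm. V.2.3.1 and C.§16] -/
theorem _root_.WeierstrassCurve.IsTateAutomorphic.isModular {F : Type} [Field F] [NumberField F]
    {W : WeierstrassCurve F} [W.IsElliptic] (hW : W.IsTateAutomorphic) (ℓ : ℕ) [Fact ℓ.Prime]
    (hcont : W.continuous_rationalGaloisRepTate ℓ) (hfin : W.module_finite_rationalTateModule ℓ)
    (h₁ : W.hasseWeilEulerFactor_geomPoints ℓ)
    (h₂ : EllipticCurves.hasseWeilEulerFactor_eq_reverse_frobCharpoly (K := F) (WeierstrassCurve.geomPoints W) ℓ) :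
    W.IsModular := by
  obtain ⟨μ, hμ, P, 𝔫, h𝔫, hev⟩ := hW
  refine ⟨μ, hμ, P, 𝔫, h𝔫, ?_⟩
  filter_upwards [hev, eventually_natCast_not_mem_asIdeal F (Fact.out : ℓ.Prime).ne_zero]
    with v hv hvℓ
  obtain ⟨hv𝔫, ϖ, α, a, hSat, hpoly, hGal⟩ := hv
  refine ⟨hv𝔫, ϖ, α, hSat, ?_⟩
  -- the Galois side at the auxiliary prime `ℓ`
  haveI hfinI : Module.Finite ℚ_[ℓ] (W.rationalTateModule ℓ) := hfin
  have hc : Continuous fun x : Field.absoluteGaloisGroup F × W.rationalTateModule ℓ =>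
      EllipticCurves.rationalTateRepresentation (Field.absoluteGaloisGroup F)
        (WeierstrassCurve.geomPoints W) ℓ x.1 x.2 := hcont
  obtain ⟨hunr, hFrob⟩ := hGal ℓ hvℓ hc hfinI
  -- the Frobenius characteristic polynomial of `V_ℓ E` at `v` is `X² - a X + q_v`
  have hfc : (EllipticCurves.rationalTateGaloisRepOf (WeierstrassCurve.geomPoints W) ℓ hc).frobCharpoly v =
      (frobPoly a v.residueCard).map (Int.castRingHom ℚ_[ℓ]) := by
    have h' := GaloisRepresentations.GaloisRep.hasFrobCharpolyAt_frobCharpoly_of_exists ⟨_, hFrob⟩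
    obtain ⟨𝔓, h𝔓⟩ := HeightOneSpectrum.primesAbove_nonempty v
    obtain ⟨σ, hσ⟩ := HeightOneSpectrum.exists_isArithFrobAt_of_mem_primesAbove_holds h𝔓
    rw [← h' 𝔓 h𝔓 σ hσ, ← hFrob 𝔓 h𝔓 σ hσ]
  -- the Euler factor of `V_ℓ E` at `v`, computed in two ways, gives `L_v(E, T) = 1 - a T + q T²`
  have hE₁ := h₁ hc hfinI v hvℓ
  have hE₂ := h₂ hc hunr
  have hloc : W.localPolynomialAt v = eulerPoly a v.residueCard := by
    apply Polynomial.map_injective (Int.castRingHom ℚ_[ℓ]) (RingHom.injective_int _)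
    rw [← hE₁, hE₂, hfc, reverse_map_frobPoly]
  -- the automorphic side: `α = {z₁, z₂}` with `√q z₁ + √q z₂ = a` and `(√q z₁)(√q z₂) = q`
  obtain ⟨z₁, z₂, rfl⟩ := Multiset.card_eq_two.1 hSat.card_eq
  set c : ℂ := ((Real.sqrt (v.residueCard : ℝ) : ℝ) : ℂ) with hc_def
  have hpoly' : (X : ℂ[X]) ^ 2 - Polynomial.C (c * z₁ + c * z₂) * X +
        Polynomial.C (c * z₁ * (c * z₂)) =
      X ^ 2 - Polynomial.C (a : ℂ) * X + Polynomial.C ((v.residueCard : ℕ) : ℂ) := by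
    rw [← X_sub_C_mul_X_sub_C]
    simpa [frobPoly, Polynomial.map_sub, Polynomial.map_add, Polynomial.map_mul,
      Polynomial.map_pow] using hpoly
  obtain ⟨hsum, hprod⟩ := coeff_quadratic_eq hpoly'
  change (W.localPolynomialAt v).map (Int.castRingHom ℂ) = _
  rw [hloc, Multiset.insert_eq_cons, Multiset.map_cons, Multiset.prod_cons, Multiset.map_singleton,
    Multiset.prod_singleton, one_sub_mul_one_sub, hsum, hprod]
  simp [eulerPoly, Polynomial.map_sub, Polynomial.map_add, Polynomial.map_mul, Polynomial.map_pow]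

/-- **lang.S28: the accepted automorphic formulation from the Galois form.** The Galois form of
lang.S28 (Allen–Calegari–Caraiani–Gee–Helm–Le Hung–Newton–Scholze–Taylor–Thorne, *Potential
automorphy over CM fields*, Ann. of Math. 197 (2023), Cor. 7.1.12 for `m = 1` applied to the
compatible system `R_E` of a non-CM elliptic curve — equivalently Thm. 1.0.1, non-CM case), taken
as the explicit **hypothesis** `hACC`. Printed Cor. 7.1.12: *Suppose that `F` is a CM field and
that `R = (M, S, {Q_v(X)}, {r_λ}, {{0,1}})` is a strongly irreducible rank `2` very weakly
compatible system of `l`-adic representations of `G_F`. If `m` is a non-negative integer, then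
there exists a finite Galois CM extension `F'/F` such that the weakly compatible system
`Symm^m R|_{G_{F'}}` is automorphic.* For an elliptic curve `E` over `F` without geometric complex
multiplication (`¬ W.HasCM`, prelude `Isogeny`) the system `R_E = (ℚ, S_E, {X² - a_v X + q_v},
{H¹_ét(E_{F̄}, ℚ̄_l) = V_l(E)^∨}, {{0,1}})` is a strongly irreducible rank-2 very weakly compatible
system (this is how the source deduces Thm. 1.0.1 and Cor. 7.1.14 from Cor. 7.1.12–7.1.13), and
`R_E|_{G_{F'}} = R_{E ×_F F'}`; the conclusion "`R_{E ×_F F'}` is automorphic" is read as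
`(W.baseChange F').IsTateAutomorphic` (all but finitely many places, unitary Satake
normalisation; module docstring). Hence `hACC` reads: *for every elliptic curve `E` without
geometric CM over a CM number field `F` (Mathlib `NumberField.IsCMField`) there is a finite
extension `F'/F`, Galois over `F` (`IsGalois F F'`), with `F'` again a CM field, such that
`E ×_F F'` is Tate-automorphic* — the statement of the former named fact
`exists_isCMField_isTateAutomorphic`, merged back into the obligation `exists_isCMField_isModular`
by the review of 2026-08-15 (D-0026: a decomposition child must not carry the whole parent); its
proof is the whole of the source (module docstring, "Proof architecture") and is *not* supplied
here. Together with the four standard facts of `IsTateAutomorphic.isModular`, granted for all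
elliptic curves over number fields at one prime `ℓ` — continuity and finite-dimensionality of
`V_ℓ E` (`TateModule`), Euler factors of `V_ℓ E` (`HasseWeilAbelian`) — it implies
`Literature.NumberTheory.Automorphic.exists_isCMField_isModular` (`Sweep1`): every elliptic curve
without geometric CM over a CM field becomes modular (`WeierstrassCurve.IsModular`) over a finite
CM extension. This exhibits the exact trust base of lang.S28 as stated in `Sweep1` (the four
facts are discharged in the `…Proofs` siblings).
[cite: AllenCalegariCaraianiGeeEtAl2023, Thm. 1.0.1 (non-CM case), via Cor. 7.1.12 (m = 1, R = R_E) with §7.1] -/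
theorem exists_isCMField_isModular_of_isTateAutomorphic (ℓ : ℕ) [Fact ℓ.Prime]
    (hACC : ∀ {F : Type} [Field F] [NumberField F] [IsCMField F] (W : WeierstrassCurve F)
      [W.IsElliptic] (_hW : ¬ W.HasCM),
      ∃ (F' : Type) (_ : Field F') (_ : NumberField F') (_ : Algebra F F'),
        IsCMField F' ∧ IsGalois F F' ∧ (W.baseChange F').IsTateAutomorphic)
    (hcont : ∀ {K : Type} [Field K] [NumberField K] (W : WeierstrassCurve K),
      W.continuous_rationalGaloisRepTate ℓ)
    (hfin : ∀ {K : Type} [Field K] [NumberField K] (W : WeierstrassCurve K),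
      W.module_finite_rationalTateModule ℓ)
    (h₁ : ∀ {K : Type} [Field K] [NumberField K] (W : WeierstrassCurve K) [W.IsElliptic],
      W.hasseWeilEulerFactor_geomPoints ℓ)
    (h₂ : ∀ {K : Type} [Field K] [NumberField K] (W : WeierstrassCurve K),
      EllipticCurves.hasseWeilEulerFactor_eq_reverse_frobCharpoly (K := K) (WeierstrassCurve.geomPoints W) ℓ) :
    exists_isCMField_isModular := by
  intro F _ _ _ W _ hW
  obtain ⟨F', _, _, _, hCM, _, hT⟩ := hACC W hW
  haveI : (W.baseChange F').IsElliptic := by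
    dsimp only [WeierstrassCurve.baseChange]
    infer_instance
  exact ⟨F', _, _, _, hCM, hT.isModular ℓ (hcont _) (hfin _) (h₁ _) (h₂ _)⟩

end TateAutomorphic

end Literature.NumberTheory.Automorphic
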